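import Summits.Ventures.WeilGRH.FlatSumChebyshev
import Literature.NumberTheory.LFunctions.SchoenfeldPsiSmall
import Literature.NumberTheory.LFunctions.ChebyshevSylvesterPsi
import HarnessLib

/-!
# rh-explicit (venture WeilGRH): THE FLAT PRIME SUM OF A WINDOW, UNCONDITIONALLY AND WITH STANDARD AXIOMS —
  Abel summation needs `ψ(t) ≤ c·t` on the window only; `ψ(x) ≤ 1.1422x` for all `x`, `ψ(x) ≤ 1.04x` below `10⁴`

Cell `rh-explicit`, WEIL TRACK (structure seat weil-3, gen12).  RH-free, no floating point, no `native_decide`.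
The flat prime sum `S(a) = Σ_{log n<2a} Λ(n)n^{-1/2}(1 − log n/2a)` is the only arithmetic quantity in the
phase-blind window budgets (`ZetaWindowPhaseBlind`, `ZetaWindowLowerBound`); `FlatSumChebyshev.flatSum_le_of_psi_le`
bounds it by `c(2(eᵃ−1)/a − 1)` given `ψ(t) ≤ c·t` for ALL `t ≥ 0`, which the tree proves with `c = 1.04` only
under RH — and through the certified-zeros files (`SchoenfeldPsiTheta.psi_le_mul`, axioms beyond the standard three,
`native_decide`).  Here:

* `flatSum_le_of_psi_le_on`: the same bound from `ψ(t) ≤ c·t` for `0 ≤ t ≤ e^{2a}` ONLY (the proof of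
  `flatSum_le_of_psi_le` uses the hypothesis on `(1, e^{2a}]`);
* `psi_le_mul_unconditional`: **`ψ(x) ≤ 1.1422·x` for all `x ≥ 0`**, standard axioms — below `10⁴` the kernel
  `lcm` computation `SchoenfeldPsiSmall.psi_le_of_le_ten_thousand` (`ψ ≤ 1.04x`, `decide +kernel`), above `10⁴`
  Sylvester's `ChebyshevSylvesterPsi.psi_le_sylvester` (`ψ ≤ 1.0722x + 7√x`, `√x ≤ x/100`); in print
  `ψ(x) < 1.03883x` for all `x > 0` (Rosser–Schoenfeld 1962, Thm 12);
* `flatSum_le_unconditional`: `S(a) ≤ 1.1422·(2(eᵃ−1)/a − 1)` for every `a > 0`;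
* `flatSum_le_of_exp_le`: `S(a) ≤ 1.04·(2(eᵃ−1)/a − 1)` whenever `e^{2a} ≤ 10⁴`.

Consumers: `CharCentralOrderExplicit` (conductor aspect under GRH(χ)), `ZetaMultiplicityExplicit` (Goldston–Gonek
explicit under RH), `ZetaZeroGapsExplicit` (zeros in every window under RH) — all with standard axioms.

No definitions, no named facts.
-/

set_option autoImplicit false

noncomputable section

open Complex Filter Set MeasureTheory Finset
open scoped Real Topology Chebyshev ArithmeticFunction.vonMangoldt

namespace Summit.Ventures.WeilGRH

open Literature.NumberTheory.LFunctions

/-! ## Abel summation with the Chebyshev bound on the window only -/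

/-- **THE FLAT PRIME SUM AGAINST A CHEBYSHEV BOUND ON THE WINDOW**: if `ψ(t) ≤ c·t` for `0 ≤ t ≤ e^{2a}`, then

  `Σ_{log n < 2a} Λ(n) n^{-1/2} (1 − log n/(2a)) ≤ c·(2(eᵃ − 1)/a − 1)`

(`FlatSumChebyshev.flatSum_le_of_psi_le`, whose proof uses the Chebyshev bound on `(1, e^{2a}]` only). -/
theorem flatSum_le_of_psi_le_on {c a : ℝ} (ha : 0 < a)
    (hψ : ∀ t : ℝ, 0 ≤ t → t ≤ Real.exp (2 * a) → ψ t ≤ c * t) :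
    ∑ n ∈ weilPrimeIndex a, (Λ n : ℝ) / Real.sqrt n * (1 - Real.log n / (2 * a)) ≤
      c * (2 * (Real.exp a - 1) / a - 1) := by
  rw [flatSum_eq_sum_Icc ha]
  set L : ℝ := 2 * a with hL
  set x : ℝ := Real.exp L with hx
  have hL0 : 0 < L := by rw [hL]; linarith
  have hx1 : 1 ≤ x := by rw [hx]; exact Real.one_le_exp (by linarith)
  have hlogx : Real.log x = L := by rw [hx, Real.log_exp]
  have hsqrtx : Real.sqrt x = Real.exp a := by
    rw [hx, hL, show 2 * a = a + a by ring, Real.exp_add, Real.sqrt_mul_self (Real.exp_pos a).le]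
  -- the weight, its derivative, and the primitive of `t(−w′)`
  set w : ℝ → ℝ := fun s ↦ (1 - Real.log s / L) / Real.sqrt s with hw
  set w' : ℝ → ℝ := fun t ↦ -((1 / L + (1 - Real.log t / L) / 2) / (t * Real.sqrt t)) with hw'
  set G : ℝ → ℝ := fun s ↦ Real.sqrt s * (1 - Real.log s / L + 4 / L) with hG
  have hderiv : ∀ t : ℝ, 0 < t → HasDerivAt w (w' t) t := fun t ht ↦ hasDerivAt_flatWeight L ht
  have hdiff : ∀ t ∈ Set.Icc 1 x, DifferentiableAt ℝ w t :=
    fun t ht ↦ (hderiv t (by linarith [ht.1])).differentiableAt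
  have hderiv_eq : ∀ t : ℝ, 0 < t → deriv w t = w' t := fun t ht ↦ (hderiv t ht).deriv
  -- continuity of `w'` and `G'` on `(0, ∞)`
  have hcontAt : ∀ t : ℝ, 0 < t → ContinuousAt w' t ∧
      ContinuousAt (fun s : ℝ ↦ (1 / L + (1 - Real.log s / L) / 2) / Real.sqrt s) t := by
    intro t ht
    have h1 : ContinuousAt Real.log t := Real.continuousAt_log ht.ne'
    have h2 : ContinuousAt Real.sqrt t := Real.continuous_sqrt.continuousAt
    have hnum : ContinuousAt (fun s : ℝ ↦ 1 / L + (1 - Real.log s / L) / 2) t :=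
      continuousAt_const.add ((continuousAt_const.sub (h1.div_const L)).div_const 2)
    have hs0 : Real.sqrt t ≠ 0 := (Real.sqrt_pos.2 ht).ne'
    exact ⟨(hnum.div (continuousAt_id.mul h2) (mul_ne_zero ht.ne' hs0)).neg, hnum.div h2 hs0⟩
  have hcont : ContinuousOn w' (Set.Icc 1 x) :=
    fun t ht ↦ ((hcontAt t (by linarith [ht.1])).1).continuousWithinAt
  have hint' : IntegrableOn w' (Set.Icc 1 x) := hcont.integrableOn_Icc
  have hint : IntegrableOn (deriv w) (Set.Icc 1 x) :=
    hint'.congr_fun (fun t ht ↦ (hderiv_eq t (by linarith [ht.1])).symm) measurableSet_Icc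
  -- Abel summation
  have habel := sum_mul_eq_sub_integral_mul₀ (fun k ↦ (Λ k : ℝ)) (by simp) x hdiff hint
  have hS : (∑ k ∈ Icc 0 ⌊x⌋₊, (1 - Real.log k / L) / Real.sqrt k * (Λ k : ℝ)) =
      ∑ k ∈ Icc 0 ⌊x⌋₊, w k * (Λ k : ℝ) := rfl
  have hwx : w x = 0 := by
    show (1 - Real.log x / L) / Real.sqrt x = 0
    rw [hlogx, div_self hL0.ne', sub_self, zero_div]
  rw [hS, habel, hwx, zero_mul, zero_sub]
  -- the integral is `∫ w'·ψ` over `(1, x]`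
  have hI : ∫ t in Set.Ioc 1 x, deriv w t * ∑ k ∈ Icc 0 ⌊t⌋₊, (Λ k : ℝ) =
      ∫ t in Set.Ioc 1 x, w' t * ψ t :=
    setIntegral_congr_fun measurableSet_Ioc fun t ht ↦ by
      rw [hderiv_eq t (by linarith [ht.1]), Chebyshev.psi_eq_sum_Icc]
  rw [hI, ← integral_neg]
  -- integrability of the two integrands on `(1, x]`
  have hIψ : IntegrableOn (fun t : ℝ ↦ w' t * ψ t) (Set.Ioc 1 x) := by
    have h := (integrableOn_mul_sum_Icc (fun k ↦ (Λ k : ℝ)) (m := 0) zero_le_one hint').mono_set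
      Set.Ioc_subset_Icc_self
    exact h.congr_fun (fun t _ ↦ by rw [Chebyshev.psi_eq_sum_Icc]) measurableSet_Ioc
  have hGcont : ContinuousOn (fun s : ℝ ↦ (1 / L + (1 - Real.log s / L) / 2) / Real.sqrt s) (Set.Icc 1 x) :=
    fun t ht ↦ ((hcontAt t (by linarith [ht.1])).2).continuousWithinAt
  have hIc : IntegrableOn (fun t : ℝ ↦ c * ((1 / L + (1 - Real.log t / L) / 2) / Real.sqrt t)) (Set.Ioc 1 x) :=
    (hGcont.integrableOn_Icc.mono_set Set.Ioc_subset_Icc_self).const_mul c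
  -- pointwise: `−w'(t)ψ(t) ≤ c·(−w'(t))·t = c·G'(t)` on `(1, x]` — the Chebyshev bound is used HERE only
  have hpt : ∀ t ∈ Set.Ioc 1 x, -(w' t * ψ t) ≤ c * ((1 / L + (1 - Real.log t / L) / 2) / Real.sqrt t) := by
    intro t ht
    have ht0 : 0 < t := by linarith [ht.1]
    have hs : 0 < Real.sqrt t := Real.sqrt_pos.2 ht0
    have hlogt : Real.log t ≤ L := by rw [← hlogx]; exact Real.log_le_log ht0 ht.2
    have hnum : 0 ≤ 1 / L + (1 - Real.log t / L) / 2 := by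
      have : 0 ≤ 1 - Real.log t / L := by rw [sub_nonneg, div_le_one hL0]; exact hlogt
      positivity
    have hK : 0 ≤ (1 / L + (1 - Real.log t / L) / 2) / (t * Real.sqrt t) := by positivity
    have hψt := hψ t ht0.le ht.2
    have e1 : -(w' t * ψ t) = (1 / L + (1 - Real.log t / L) / 2) / (t * Real.sqrt t) * ψ t := by
      rw [hw']; ring
    have e2 : c * ((1 / L + (1 - Real.log t / L) / 2) / Real.sqrt t) =
        (1 / L + (1 - Real.log t / L) / 2) / (t * Real.sqrt t) * (c * t) := by
      field_simp
    rw [e1, e2]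
    exact mul_le_mul_of_nonneg_left hψt hK
  have hmono : ∫ t in Set.Ioc 1 x, -(w' t * ψ t) ≤
      ∫ t in Set.Ioc 1 x, c * ((1 / L + (1 - Real.log t / L) / 2) / Real.sqrt t) :=
    setIntegral_mono_on hIψ.neg hIc measurableSet_Ioc hpt
  refine hmono.trans (le_of_eq ?_)
  -- evaluate `∫₁^x c·G' = c·(G(x) − G(1)) = c·(2(eᵃ − 1)/a − 1)`
  have hGcont' : ContinuousOn (fun s : ℝ ↦ (1 / L + (1 - Real.log s / L) / 2) / Real.sqrt s) (Set.uIcc 1 x) := by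
    rwa [Set.uIcc_of_le hx1]
  have hFTC : ∫ t in Set.Ioc 1 x, (1 / L + (1 - Real.log t / L) / 2) / Real.sqrt t = G x - G 1 := by
    rw [← intervalIntegral.integral_of_le hx1]
    refine intervalIntegral.integral_eq_sub_of_hasDerivAt (fun t ht ↦ hasDerivAt_flatWeightPrim L ?_)
      hGcont'.intervalIntegrable
    rw [Set.uIcc_of_le hx1] at ht
    linarith [ht.1]
  have hGval : G x - G 1 = 2 * (Real.exp a - 1) / a - 1 := by
    show Real.sqrt x * (1 - Real.log x / L + 4 / L) - Real.sqrt 1 * (1 - Real.log 1 / L + 4 / L) =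
      2 * (Real.exp a - 1) / a - 1
    rw [hsqrtx, hlogx, Real.sqrt_one, Real.log_one, hL]
    field_simp
    ring
  rw [integral_const_mul, hFTC, hGval]

/-! ## An unconditional linear Chebyshev bound from the tree's kernel-checked estimates -/

/-- **`ψ(x) ≤ 1.1422·x` for every `x ≥ 0`, unconditionally, standard axioms**: below `10⁴` by the kernel
computation `ψ(x) ≤ 1.04x` (`SchoenfeldPsiSmall`, `decide +kernel` on `lcm(1,…,n)`), above `10⁴` by Sylvester's
`ψ(x) ≤ 1.0722x + 7√x` (`ChebyshevSylvesterPsi`) and `√x ≤ x/100`.  (Print: `ψ(x) < 1.03883x` for all `x > 0`,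
Rosser–Schoenfeld 1962, Thm 12.) -/
theorem psi_le_mul_unconditional {x : ℝ} (hx : 0 ≤ x) : ψ x ≤ 1.1422 * x := by
  rcases le_or_gt x 10000 with h | h
  · exact (SchoenfeldBound.psi_le_of_le_ten_thousand hx h).trans (by nlinarith)
  · have hψ := psi_le_sylvester hx
    have hs0 : 0 ≤ Real.sqrt x := Real.sqrt_nonneg x
    have hsq : Real.sqrt x * Real.sqrt x = x := Real.mul_self_sqrt hx
    have h100 : 100 ≤ Real.sqrt x := by
      rw [show (100 : ℝ) = Real.sqrt (100 ^ 2) by rw [Real.sqrt_sq (by norm_num)]]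
      exact Real.sqrt_le_sqrt (by nlinarith)
    have hsx : 100 * Real.sqrt x ≤ x := by nlinarith
    nlinarith

/-- **The flat prime sum, unconditionally**: `S(a) ≤ 1.1422·(2(eᵃ − 1)/a − 1)` for every `a > 0`. -/
theorem flatSum_le_unconditional {a : ℝ} (ha : 0 < a) :
    ∑ n ∈ weilPrimeIndex a, (Λ n : ℝ) / Real.sqrt n * (1 - Real.log n / (2 * a)) ≤
      1.1422 * (2 * (Real.exp a - 1) / a - 1) :=
  flatSum_le_of_psi_le_on ha fun _ ht _ ↦ psi_le_mul_unconditional ht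

/-- **The flat prime sum with the printed-size constant on short windows**: if `e^{2a} ≤ 10⁴` then
`S(a) ≤ 1.04·(2(eᵃ − 1)/a − 1)` (only the kernel computation `ψ(t) ≤ 1.04t`, `t ≤ 10⁴`, enters). -/
theorem flatSum_le_of_exp_le {a : ℝ} (ha : 0 < a) (h : Real.exp (2 * a) ≤ 10000) :
    ∑ n ∈ weilPrimeIndex a, (Λ n : ℝ) / Real.sqrt n * (1 - Real.log n / (2 * a)) ≤
      1.04 * (2 * (Real.exp a - 1) / a - 1) :=
  flatSum_le_of_psi_le_on ha fun _ ht htx ↦ SchoenfeldBound.psi_le_of_le_ten_thousand ht (htx.trans h)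

end Summit.Ventures.WeilGRH

end
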